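import Mathlib
import HarnessLib
import Literature.NumberTheory.LFunctions.ZetaScrew
import Literature.NumberTheory.LFunctions.ZetaScrewThm41Proofs
import Summits.RiemannHypothesis.RiemannHypothesis.Theorems.IntegerScrewDefs

/-!
# Route `IntegerScrew` — the HINGE SPLIT of the screw matrices, I: the integer-cell Gram atoms
# (SCREW column, rung S-P (P3) «prime-side structured decomposition»; RH-FREE)

Suzuki's screw matrices `S_M = screwMatrix (M − 1) = [Ψ(log a) + Ψ(log b) − Ψ(log a − log b)]_{2 ≤ a,b ≤ M}`
(`IntegerScrewDefs`; `Ψ = zetaScrew`, Suzuki2023 (1.1)) admit an EXACT «Toeplitz-in-log» normal form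
`S_M = P⁺_M − P⁻_M` with BOTH parts positive semidefinite and completely explicit (file II,
`IntegerScrewHingeSplit`: `screwMatrix_eq_hingePos_sub_hingeNeg`).  Every profile
`φ ∈ {|·|, min(|·|, log q), 1 − e^{−λ|·|}}` entering `Ψ` has a Kreĭn–Gram matrix `[φ(x) + φ(y) − φ(|x − y|)]`
on the nodes `x = log m` which is a NONNEGATIVE COMBINATION OF INTEGER-INDEXED RANK-ONE PROJECTORS: the
moving-average factor `J[s, m] = h(s) − h(s − log m)` is a step function of `e^s` with integer breakpoints,
so it can be discretised on the cells `s ∈ [log r, log(r+1))`, `r ≥ 1`, of weight `log(1 + 1/r)`.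
This file proves the entry formulas and positive semidefiniteness of three of the atoms:

* `minGram n`   — `[min(log a, log b)] = Σ_{r ≥ 1} log(1+1/r)·u_r u_rᵀ`, `u_r(m) = [r < m]` (Brownian part);
* `boxGram n q` — `[min(log a, log q) + min(log b, log q) − min(|log a − log b|, log q)]`
                  `= Σ_{r ≥ 1} log(1+1/r)·v_r v_rᵀ`, `v_r(m) = [r < q] − [m ≤ r < mq]` (boxcar atom, width `log q`);
* `ouGram n λ`  — `[1 − a^{−λ} − b^{−λ} + (min/max)^{λ}] = d dᵀ + Σ_{r ≥ 1} (1 − (r/(r+1))^{2λ})·g_r g_rᵀ`,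
                  `d(m) = 1 − m^{−λ}`, `g_r(m) = ((r+1)/m)^{λ}[r < m]` (Ornstein–Uhlenbeck atom of rate `λ`),

together with the bookkeeping (`nd`, `xl`, `ind`, `cellWeight`, telescoping) shared with file II.

LABEL (LADDER-RH §5 rule 4): RH-FREE — elementary identities and positivity of explicit finite matrices;
no zeros of `ζ` are involved and nothing here bears on the truth of RH.
Source of the decomposition: rh-explicit SOS census (Toeplitz-in-log ansatz), HOME/sos/D4-TOEPLITZLOG-STRUCTURED-SOS-eng3.md
§0 identity (I1).  References: M. Suzuki, J. Lond. Math. Soc. (2) 108 (2023) 1448–1487 = arXiv:2206.03682,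
(1.1), (1.4) [Suzuki2023].
-/

noncomputable section

-- D-0017: `Summit.<S>.<S>.…` is the designed namespace of a single-problem summit.
set_option linter.dupNamespace false

namespace Summit.RiemannHypothesis.RiemannHypothesis.Theorems.IntegerScrew

namespace HingeSplit

open Literature.NumberTheory.LFunctions Literature.NumberTheory.LFunctions.Suzuki2023Thm41 Finset Matrix

variable {n : ℕ}

/-! ### Nodes, cells, indicators -/

/-- The integer label `m = i + 2` of row `i` of `screwMatrix n` (nodes `2, …, n + 1`). [folklore] -/
def nd (i : Fin n) : ℕ := (i : ℕ) + 2

/-- The node `x_i = log(i + 2)`. [folklore] -/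
def xl (i : Fin n) : ℝ := Real.log (nd i : ℝ)

/-- `2 ≤ nd i`. [folklore] -/
theorem two_le_nd (i : Fin n) : 2 ≤ nd i := by unfold nd; omega

/-- `nd i ≤ n + 1`. [folklore] -/
theorem nd_le (i : Fin n) : nd i ≤ n + 1 := by unfold nd; omega

/-- `0 < nd i` in `ℝ`. [folklore] -/
theorem nd_pos (i : Fin n) : (0 : ℝ) < nd i := by
  have := two_le_nd i; exact_mod_cast (by omega : 0 < nd i)

/-- `0 ≤ x_i`. [folklore] -/
theorem xl_nonneg (i : Fin n) : 0 ≤ xl i :=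
  Real.log_nonneg (by have := two_le_nd i; exact_mod_cast (by omega : 1 ≤ nd i))

/-- `screwMatrix n i j = G(x_i, x_j)` (definitional). [folklore] -/
theorem screwMatrix_apply (i j : Fin n) : screwMatrix n i j = zetaScrewKernel (xl i) (xl j) := rfl

/-- The indicator of a finite set of naturals, as a real number. [folklore] -/
def ind (s : Finset ℕ) (r : ℕ) : ℝ := if r ∈ s then 1 else 0

/-- `1_s · 1_t = 1_{s ∩ t}`. [folklore] -/
theorem ind_mul_ind (s t : Finset ℕ) (r : ℕ) : ind s r * ind t r = ind (s ∩ t) r := by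
  unfold ind
  by_cases hs : r ∈ s <;> by_cases ht : r ∈ t <;> simp [hs, ht]

/-- `Σ_{r ∈ u} f(r)·1_s(r) = Σ_{r ∈ s} f(r)` when `s ⊆ u`. [folklore] -/
theorem sum_mul_ind {u s : Finset ℕ} (h : s ⊆ u) (f : ℕ → ℝ) :
    ∑ r ∈ u, f r * ind s r = ∑ r ∈ s, f r := by
  unfold ind
  simp_rw [mul_ite, mul_one, mul_zero]
  rw [Finset.sum_ite_mem, Finset.inter_eq_right.2 h]

/-- Telescoping over an integer interval: `Σ_{r ∈ [P,Q)} (f(r+1) − f(r)) = f(Q) − f(P)` (`P ≤ Q`). [folklore] -/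
theorem sum_Ico_telescope (f : ℕ → ℝ) {P Q : ℕ} (h : P ≤ Q) :
    ∑ r ∈ Ico P Q, (f (r + 1) - f r) = f Q - f P := by
  induction Q, h using Nat.le_induction with
  | base => simp
  | succ Q hPQ ih => rw [Finset.sum_Ico_succ_top hPQ, ih]; ring

/-- The weight `log(r+1) − log r = log(1 + 1/r)` of the integer cell `[r, r+1)` (the length of
`[log r, log(r+1))`). [folklore] -/
def cellWeight (r : ℕ) : ℝ := Real.log ((r + 1 : ℕ) : ℝ) - Real.log (r : ℝ)

/-- `cellWeight r ≥ 0`. [folklore] -/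
theorem cellWeight_nonneg (r : ℕ) : 0 ≤ cellWeight r := by
  unfold cellWeight
  rcases Nat.eq_zero_or_pos r with h | h
  · subst h; simp
  · exact sub_nonneg.2 (Real.log_le_log (by exact_mod_cast h) (by push_cast; linarith))

/-- `Σ_{r ∈ [P,Q)} cellWeight r = log(max(P,Q)) − log P`. [folklore] -/
theorem sum_Ico_cellWeight (P Q : ℕ) :
    ∑ r ∈ Ico P Q, cellWeight r = Real.log ((max P Q : ℕ) : ℝ) - Real.log (P : ℝ) := by
  rcases le_total P Q with h | h
  · rw [max_eq_right h]
    exact sum_Ico_telescope (fun r : ℕ => Real.log (r : ℝ)) h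
  · rw [max_eq_left h, Finset.Ico_eq_empty (not_lt.2 h), Finset.sum_empty, sub_self]

/-- `log` is monotone on the naturals (with `log 0 = 0`). [folklore] -/
theorem log_nat_mono {a b : ℕ} (h : a ≤ b) : Real.log (a : ℝ) ≤ Real.log (b : ℝ) := by
  rcases Nat.eq_zero_or_pos a with ha | ha
  · subst ha; simp only [Nat.cast_zero, Real.log_zero]; exact Real.log_natCast_nonneg b
  · exact Real.log_le_log (by exact_mod_cast ha) (by exact_mod_cast h)

/-- `log(min(a,b)) = min(log a, log b)` for naturals. [folklore] -/
theorem log_nat_min (a b : ℕ) : Real.log ((min a b : ℕ) : ℝ) = min (Real.log a) (Real.log b) := by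
  rcases le_total a b with h | h
  · rw [min_eq_left h, min_eq_left (log_nat_mono h)]
  · rw [min_eq_right h, min_eq_right (log_nat_mono h)]

/-- `log(max(a,b)) = max(log a, log b)` for naturals. [folklore] -/
theorem log_nat_max (a b : ℕ) : Real.log ((max a b : ℕ) : ℝ) = max (Real.log a) (Real.log b) := by
  rcases le_total a b with h | h
  · rw [max_eq_right h, max_eq_right (log_nat_mono h)]
  · rw [max_eq_left h, max_eq_left (log_nat_mono h)]

/-- `|log a − log b| = log(max(a,b)) − log(min(a,b))`. [folklore] -/
theorem abs_log_sub_log (a b : ℕ) :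
    |Real.log a - Real.log b| = Real.log ((max a b : ℕ) : ℝ) - Real.log ((min a b : ℕ) : ℝ) := by
  rw [log_nat_max, log_nat_min, max_sub_min_eq_abs']

/-- A rank-one projector `u uᵀ` is positive semidefinite (real case of
`Matrix.posSemidef_vecMulVec_self_star`). [folklore] -/
theorem posSemidef_vecMulVec_self (u : Fin n → ℝ) : (vecMulVec u u).PosSemidef := by
  simpa using Matrix.posSemidef_vecMulVec_self_star u

/-- A nonnegative combination of rank-one projectors is positive semidefinite. [folklore] -/
theorem posSemidef_sum_smul_vecMulVec (s : Finset ℕ) (w : ℕ → ℝ) (u : ℕ → Fin n → ℝ)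
    (hw : ∀ r ∈ s, 0 ≤ w r) : (∑ r ∈ s, w r • vecMulVec (u r) (u r)).PosSemidef :=
  posSemidef_sum s fun r hr => (posSemidef_vecMulVec_self (u r)).smul (hw r hr)

/-- Entry of a weighted sum of rank-one projectors. [folklore] -/
theorem sum_smul_vecMulVec_apply (s : Finset ℕ) (w : ℕ → ℝ) (u : ℕ → Fin n → ℝ) (i j : Fin n) :
    (∑ r ∈ s, w r • vecMulVec (u r) (u r)) i j = ∑ r ∈ s, w r * (u r i * u r j) := by
  simp [Matrix.sum_apply, vecMulVec_apply]

/-! ### The Brownian part `[min(log a, log b)]` -/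

/-- `u_r(m) = [1 ≤ r < m]`. [folklore] -/
def stepVec (n r : ℕ) : Fin n → ℝ := fun i => ind (Ico 1 (nd i)) r

/-- `minGram n = Σ_{1 ≤ r < n+2} (log(r+1) − log r)·u_r u_rᵀ`. [folklore] -/
def minGram (n : ℕ) : Matrix (Fin n) (Fin n) ℝ :=
  ∑ r ∈ Ico 1 (n + 2), cellWeight r • vecMulVec (stepVec n r) (stepVec n r)

/-- `minGram n ⪰ 0`. [folklore] -/
theorem minGram_posSemidef (n : ℕ) : (minGram n).PosSemidef :=
  posSemidef_sum_smul_vecMulVec _ _ _ fun r _ => cellWeight_nonneg r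

/-- `minGram n i j = min(x_i, x_j)`. [folklore] -/
theorem minGram_apply (i j : Fin n) : minGram n i j = min (xl i) (xl j) := by
  rw [minGram, sum_smul_vecMulVec_apply]
  simp_rw [stepVec, ind_mul_ind, Finset.Ico_inter_Ico]
  have hsub : Ico (max 1 1) (min (nd i) (nd j)) ⊆ Ico 1 (n + 2) :=
    Finset.Ico_subset_Ico (by simp) (by have := nd_le i; omega)
  rw [sum_mul_ind hsub, sum_Ico_cellWeight, xl, xl, ← log_nat_min]
  have : max (max 1 1) (min (nd i) (nd j)) = min (nd i) (nd j) :=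
    max_eq_right (by have := two_le_nd i; have := two_le_nd j; omega)
  rw [this]; simp

/-! ### The boxcar atoms `[min(x, log q) + min(y, log q) − min(|x − y|, log q)]` -/

/-- `v_r(m) = [1 ≤ r < q] − [m ≤ r < mq]`. [folklore] -/
def boxVec (n q r : ℕ) : Fin n → ℝ := fun i => ind (Ico 1 q) r - ind (Ico (nd i) (nd i * q)) r

/-- `boxGram n q = Σ_{1 ≤ r < (n+2)q} (log(r+1) − log r)·v_r v_rᵀ` — the Gram matrix of the boxcar
moving average of width `log q` on the nodes, discretised on the integer cells. [folklore] -/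
def boxGram (n q : ℕ) : Matrix (Fin n) (Fin n) ℝ :=
  ∑ r ∈ Ico 1 ((n + 2) * q), cellWeight r • vecMulVec (boxVec n q r) (boxVec n q r)

/-- `boxGram n q ⪰ 0`. [folklore] -/
theorem boxGram_posSemidef (n q : ℕ) : (boxGram n q).PosSemidef :=
  posSemidef_sum_smul_vecMulVec _ _ _ fun r _ => cellWeight_nonneg r

/-- The boxcar entry formula in integer form:
`boxGram n q i j = log q − (log(max(b,q)) − log b) − (log(max(a,q)) − log a)
  + (log(max(max(a,b), min(a,b)·q)) − log(max(a,b)))`, `a = nd i`, `b = nd j` (`q ≥ 1`). [folklore] -/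
theorem boxGram_apply_nat {q : ℕ} (hq : 1 ≤ q) (i j : Fin n) :
    boxGram n q i j = Real.log q
      - (Real.log ((max (nd j) q : ℕ) : ℝ) - Real.log (nd j))
      - (Real.log ((max (nd i) q : ℕ) : ℝ) - Real.log (nd i))
      + (Real.log ((max (max (nd i) (nd j)) (min (nd i) (nd j) * q) : ℕ) : ℝ)
          - Real.log ((max (nd i) (nd j) : ℕ) : ℝ)) := by
  have hi := two_le_nd i; have hj := two_le_nd j; have hin := nd_le i; have hjn := nd_le j
  rw [boxGram, sum_smul_vecMulVec_apply]
  have hexp : ∀ r : ℕ, cellWeight r * (boxVec n q r i * boxVec n q r j) =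
      cellWeight r * ind (Ico 1 q ∩ Ico 1 q) r - cellWeight r * ind (Ico 1 q ∩ Ico (nd j) (nd j * q)) r
      - cellWeight r * ind (Ico (nd i) (nd i * q) ∩ Ico 1 q) r
      + cellWeight r * ind (Ico (nd i) (nd i * q) ∩ Ico (nd j) (nd j * q)) r := by
    intro r; simp only [boxVec, ← ind_mul_ind]; ring
  simp_rw [hexp, Finset.sum_add_distrib, Finset.sum_sub_distrib, Finset.Ico_inter_Ico]
  have h2 : max 1 (nd j) = nd j := max_eq_right (by omega)
  have h3 : max (nd i) 1 = nd i := max_eq_left (by omega)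
  have h4 : min q (nd j * q) = q := min_eq_left (Nat.le_mul_of_pos_left q (by omega))
  have h5 : min (nd i * q) q = q := min_eq_right (Nat.le_mul_of_pos_left q (by omega))
  have h6 : min (nd i * q) (nd j * q) = min (nd i) (nd j) * q := min_mul_mul_right _ _ _
  simp only [max_self, min_self, h2, h3, h4, h5, h6]
  have hR : ∀ {P Q : ℕ}, 1 ≤ P → Q ≤ (n + 1) * q → Ico P Q ⊆ Ico 1 ((n + 2) * q) := fun hP hQ =>
    Finset.Ico_subset_Ico hP (hQ.trans (Nat.mul_le_mul_right q (by omega)))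
  have hqle : q ≤ (n + 1) * q := Nat.le_mul_of_pos_left q (by omega)
  rw [sum_mul_ind (hR le_rfl hqle), sum_mul_ind (hR (by omega) hqle), sum_mul_ind (hR (by omega) hqle),
    sum_mul_ind (hR (le_max_of_le_left (by omega))
      (Nat.mul_le_mul_right q ((min_le_left _ _).trans hin)))]
  simp only [sum_Ico_cellWeight, max_eq_right hq, Nat.cast_one, Real.log_one, sub_zero]

/-- The boxcar entry formula: `boxGram n q i j = min(x_i, log q) + min(x_j, log q) − min(|x_i − x_j|, log q)`
(`q ≥ 1`), i.e. `boxGram n q` is the Kreĭn–Gram matrix of the profile `min(|u|, log q)` on the nodes. [folklore] -/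
theorem boxGram_apply {q : ℕ} (hq : 1 ≤ q) (i j : Fin n) :
    boxGram n q i j = min (xl i) (Real.log q) + min (xl j) (Real.log q)
      - min |xl i - xl j| (Real.log q) := by
  rw [boxGram_apply_nat hq, xl, xl, abs_log_sub_log, ← log_nat_min, ← log_nat_min]
  have hi := two_le_nd i; have hj := two_le_nd j
  have hq0 : (0 : ℝ) < q := by exact_mod_cast hq
  -- log(max(m, q)) + log(min(m, q)) = log m + log q
  have hmm : ∀ m : ℕ, 1 ≤ m → Real.log ((max m q : ℕ) : ℝ) + Real.log ((min m q : ℕ) : ℝ)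
      = Real.log m + Real.log q := by
    intro m hm
    have hm0 : (0 : ℝ) < m := by exact_mod_cast hm
    rw [← Real.log_mul (by positivity) (by positivity), ← Real.log_mul hm0.ne' hq0.ne',
      ← Nat.cast_mul, ← Nat.cast_mul, mul_comm, min_mul_max]
  have hA := hmm (nd i) (by omega); have hB := hmm (nd j) (by omega)
  -- the last bracket
  set mx := max (nd i) (nd j) with hmx
  set mn := min (nd i) (nd j) with hmn
  have hmn1 : 1 ≤ mn := by rw [hmn]; exact le_min (by omega) (by omega)
  have hmx0 : (0 : ℝ) < mx := by have : 1 ≤ mx := le_max_of_le_left (by omega); exact_mod_cast this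
  have hmn0 : (0 : ℝ) < mn := by exact_mod_cast hmn1
  have hprod : Real.log (mx : ℝ) + Real.log (mn : ℝ) = Real.log (nd i) + Real.log (nd j) := by
    rw [← Real.log_mul hmx0.ne' hmn0.ne', ← Real.log_mul (nd_pos i).ne' (nd_pos j).ne',
      ← Nat.cast_mul, ← Nat.cast_mul, hmx, hmn, mul_comm, min_mul_max]
  have hlast : Real.log ((max mx (mn * q) : ℕ) : ℝ) - Real.log (mx : ℝ)
      = Real.log q - min (Real.log (mx : ℝ) - Real.log (mn : ℝ)) (Real.log q) := by
    rcases le_total mx (mn * q) with h | h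
    · rw [max_eq_right h, Nat.cast_mul, Real.log_mul hmn0.ne' hq0.ne']
      have : Real.log (mx : ℝ) ≤ Real.log (mn : ℝ) + Real.log q := by
        rw [← Real.log_mul hmn0.ne' hq0.ne']
        exact Real.log_le_log hmx0 (by exact_mod_cast h)
      rw [min_eq_left (by linarith)]; ring
    · rw [max_eq_left h]
      have : Real.log (mn : ℝ) + Real.log q ≤ Real.log (mx : ℝ) := by
        rw [← Real.log_mul hmn0.ne' hq0.ne']
        exact Real.log_le_log (by positivity) (by exact_mod_cast h)
      rw [min_eq_right (by linarith)]; ring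
  rw [hlast]
  linarith

/-! ### The Ornstein–Uhlenbeck atoms `[1 − e^{−λx} − e^{−λy} + e^{−λ|x−y|}]` -/

/-- `d(m) = 1 − m^{−λ}`. [folklore] -/
def ouDVec (n : ℕ) (l : ℝ) : Fin n → ℝ := fun i => 1 - Real.exp (-(l * xl i))

/-- `g_r(m) = ((r+1)/m)^{λ}·[1 ≤ r < m]`. [folklore] -/
def ouGVec (n : ℕ) (l : ℝ) (r : ℕ) : Fin n → ℝ := fun i =>
  ind (Ico 1 (nd i)) r * Real.exp (l * (Real.log ((r + 1 : ℕ) : ℝ) - xl i))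

/-- The cell weight `1 − (r/(r+1))^{2λ}` of the OU atom. [folklore] -/
def ouWeight (l : ℝ) (r : ℕ) : ℝ :=
  1 - Real.exp (2 * l * (Real.log (r : ℝ) - Real.log ((r + 1 : ℕ) : ℝ)))

/-- `ouWeight λ r ≥ 0` for `λ ≥ 0`. [folklore] -/
theorem ouWeight_nonneg {l : ℝ} (hl : 0 ≤ l) (r : ℕ) : 0 ≤ ouWeight l r := by
  unfold ouWeight
  have := cellWeight_nonneg r
  unfold cellWeight at this
  have h : 2 * l * (Real.log (r : ℝ) - Real.log ((r + 1 : ℕ) : ℝ)) ≤ 0 :=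
    mul_nonpos_of_nonneg_of_nonpos (by positivity) (by linarith)
  linarith [Real.exp_le_one_iff.2 h]

/-- `ouGram n λ = d dᵀ + Σ_{1 ≤ r < n+2} (1 − (r/(r+1))^{2λ})·g_r g_rᵀ`. [folklore] -/
def ouGram (n : ℕ) (l : ℝ) : Matrix (Fin n) (Fin n) ℝ :=
  vecMulVec (ouDVec n l) (ouDVec n l) +
    ∑ r ∈ Ico 1 (n + 2), ouWeight l r • vecMulVec (ouGVec n l r) (ouGVec n l r)

/-- `ouGram n λ ⪰ 0` for `λ ≥ 0`. [folklore] -/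
theorem ouGram_posSemidef (n : ℕ) {l : ℝ} (hl : 0 ≤ l) : (ouGram n l).PosSemidef :=
  (posSemidef_vecMulVec_self _).add (posSemidef_sum_smul_vecMulVec _ _ _ fun r _ => ouWeight_nonneg hl r)

/-- The OU kernel `E_λ(x, y) = 1 − e^{−λx} − e^{−λy} + e^{−λ|x − y|}`. [folklore] -/
def ouKernel (l x y : ℝ) : ℝ := 1 - Real.exp (-(l * x)) - Real.exp (-(l * y)) + Real.exp (-(l * |x - y|))

/-- The OU entry formula: `ouGram n λ i j = 1 − e^{−λx_i} − e^{−λx_j} + e^{−λ|x_i − x_j|}`. [folklore] -/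
theorem ouGram_apply (l : ℝ) (i j : Fin n) : ouGram n l i j = ouKernel l (xl i) (xl j) := by
  have hi := two_le_nd i; have hj := two_le_nd j; have hin := nd_le i
  rw [ouGram, Matrix.add_apply, vecMulVec_apply, sum_smul_vecMulVec_apply]
  -- the cell sum telescopes
  set f : ℕ → ℝ := fun r => Real.exp (l * (2 * Real.log (r : ℝ) - xl i - xl j)) with hf
  have hterm : ∀ r : ℕ, ouWeight l r * (ouGVec n l r i * ouGVec n l r j)
      = (f (r + 1) - f r) * ind (Ico (max 1 1) (min (nd i) (nd j))) r := by
    intro r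
    have : ouGVec n l r i * ouGVec n l r j = ind (Ico (max 1 1) (min (nd i) (nd j))) r *
        Real.exp (l * (2 * Real.log ((r + 1 : ℕ) : ℝ) - xl i - xl j)) := by
      simp only [ouGVec]
      rw [← Finset.Ico_inter_Ico, ← ind_mul_ind, mul_mul_mul_comm, ← Real.exp_add]; ring_nf
    rw [this, ouWeight, hf]
    have hC : Real.exp (l * (2 * Real.log (r : ℝ) - xl i - xl j)) =
        Real.exp (2 * l * (Real.log (r : ℝ) - Real.log ((r + 1 : ℕ) : ℝ))) *
          Real.exp (l * (2 * Real.log ((r + 1 : ℕ) : ℝ) - xl i - xl j)) := by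
      rw [← Real.exp_add]; congr 1; ring
    simp only [hC]
    ring
  simp_rw [hterm]
  have hsub : Ico (max 1 1) (min (nd i) (nd j)) ⊆ Ico 1 (n + 2) :=
    Finset.Ico_subset_Ico (by simp) (by omega)
  rw [sum_mul_ind hsub, show max 1 1 = 1 from rfl,
    sum_Ico_telescope f (show 1 ≤ min (nd i) (nd j) from le_min (by omega) (by omega))]
  -- evaluate f at the endpoints
  have hf1 : f 1 = Real.exp (-(l * xl i)) * Real.exp (-(l * xl j)) := by
    rw [hf]; simp only [Nat.cast_one, Real.log_one, mul_zero, zero_sub]; rw [← Real.exp_add]; ring_nf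
  have hfm : f (min (nd i) (nd j)) = Real.exp (-(l * |xl i - xl j|)) := by
    rw [hf, xl, xl, abs_log_sub_log]
    simp only
    have hprod : Real.log ((max (nd i) (nd j) : ℕ) : ℝ) + Real.log ((min (nd i) (nd j) : ℕ) : ℝ)
        = Real.log (nd i) + Real.log (nd j) := by
      have h1 : (0:ℝ) < (max (nd i) (nd j) : ℕ) := by
        have : 1 ≤ max (nd i) (nd j) := le_max_of_le_left (by omega)
        exact_mod_cast this
      have h2 : (0:ℝ) < (min (nd i) (nd j) : ℕ) := by
        have : 1 ≤ min (nd i) (nd j) := le_min (by omega) (by omega)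
        exact_mod_cast this
      rw [← Real.log_mul h1.ne' h2.ne', ← Real.log_mul (nd_pos i).ne' (nd_pos j).ne',
        ← Nat.cast_mul, ← Nat.cast_mul, mul_comm, min_mul_max]
    have hlin : 2 * Real.log ((min (nd i) (nd j) : ℕ) : ℝ) - Real.log (nd i) - Real.log (nd j)
        = -(Real.log ((max (nd i) (nd j) : ℕ) : ℝ) - Real.log ((min (nd i) (nd j) : ℕ) : ℝ)) := by
      linarith
    congr 1; rw [hlin]; ring
  rw [hf1, hfm, ouDVec, ouDVec, ouKernel]
  ring

/-- `|E_λ(x, y)| ≤ 2` for `λ, x, y ≥ 0`. [folklore] -/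
theorem abs_ouKernel_le {l x y : ℝ} (hl : 0 ≤ l) (hx : 0 ≤ x) (hy : 0 ≤ y) : |ouKernel l x y| ≤ 2 := by
  unfold ouKernel
  have h1 := Real.exp_le_one_iff.2 (show -(l * x) ≤ 0 by nlinarith)
  have h2 := Real.exp_le_one_iff.2 (show -(l * y) ≤ 0 by nlinarith)
  have h3 := Real.exp_le_one_iff.2 (show -(l * |x - y|) ≤ 0 by nlinarith [abs_nonneg (x - y)])
  have := Real.exp_pos (-(l * x)); have := Real.exp_pos (-(l * y)); have := Real.exp_pos (-(l * |x - y|))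
  rw [abs_le]; constructor <;> linarith

end HingeSplit

end Summit.RiemannHypothesis.RiemannHypothesis.Theorems.IntegerScrew
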